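import Summits.Ventures.PercRepro.C041RcPortINV

/-!
# Admissibility is per sub-zone, validity is a property of `K(S)` — facts (F2) and (F3) of C-041.md §11 on a single
cube state (p6, gen 26)

Setting of `C041RcPortINV` (a skeleton `(G; a, b, c)`, a cube state `S` of a bare colouring `O`).  The SUB-ZONES of
`S` are its blue bare clusters (`BlueBareConn a b S`: the components of `(Z, B_Z ∖ X_Z)` of §11, read on the whole
graph); a sub-zone is ATTACHED to the terminal `t` when one of its vertices carries a blue edge to `t`
(`Attached a b S v t`).  Two walk lemmas — a blue walk from a non-terminal stays in its sub-zone or leaves it through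
an attachment (`blueBareConn_or_attached_of_conn_compl`), the red analogue on the red bare cluster `K(S) =
BareReach a b c S` (`bareReach_or_redAttached_of_conn`) — give:

* **(F2)** `adm_iff`: the admissibility of a state (`c`, `a`, `b` pairwise blue-disconnected) is «every edge between the
  terminals is red, no sub-zone is attached to both terminals, and the sub-zone of `c` is attached to neither» —
  a conjunction of per-sub-zone conditions (`isCubeState_iff` restates `IsCubeState`);
* **(F3)** `valid_iff` / `rcInvalid_iff`: with an edge between the terminals (`12 ∈ E`) a cube state is valid iff some
  vertex of `K(S)` carries a red terminal edge, i.e. invalid iff every terminal edge at `K(S)` is blue («blue at `K`»).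

These are the single-state halves of the dictionary of §11 (e); the zone split itself is not typed here.
-/

namespace PercRepro

namespace MultiGraph

open Finset

variable {V E : Type*} {G : MultiGraph V E}

section Attached

variable (G) (a b : V)

/-- The sub-zone of `v` in `S` (its blue bare cluster) is attached to the terminal `t`: some vertex of it carries a
blue edge to `t`. -/
def Attached (S : Config E) (v t : V) : Prop :=
  ∃ w, G.BlueBareConn a b S v w ∧ ∃ e, S e = false ∧ G.Joins e w t

/-- The sub-zone of `v` in `S` is red-attached to `t` along the red bare cluster of `v`: some vertex red-bare-reachable
from `v` carries a red edge to `t`. -/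
def RedAttached (S : Config E) (v t : V) : Prop :=
  ∃ w, Relation.ReflTransGen (G.BareAdj a b S) v w ∧ ∃ e, S e = true ∧ G.Joins e w t

variable {G a b}

/-- A blue edge between two non-terminals is a blue bare adjacency. -/
theorem blueBareAdj_of_openAdj_compl {S : Config E} {u v : V} (h : G.OpenAdj Sᶜ u v)
    (hu : u ≠ a ∧ u ≠ b) (hv : v ≠ a ∧ v ≠ b) : G.BlueBareAdj a b S u v := by
  obtain ⟨e, hSe, hj⟩ := h
  refine ⟨e, ⟨?_, ?_⟩, ?_, hj⟩
  · rintro (h1 | h1) <;> rcases hj with ⟨h2, h3⟩ | ⟨h2, h3⟩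
    · exact hu.1 (h2 ▸ h1)
    · exact hv.1 (h2 ▸ h1)
    · exact hv.1 (h3 ▸ h1)
    · exact hu.1 (h3 ▸ h1)
  · rintro (h1 | h1) <;> rcases hj with ⟨h2, h3⟩ | ⟨h2, h3⟩
    · exact hu.2 (h2 ▸ h1)
    · exact hv.2 (h2 ▸ h1)
    · exact hv.2 (h3 ▸ h1)
    · exact hu.2 (h3 ▸ h1)
  · rw [compl_apply_not] at hSe
    cases h : S e
    · rfl
    · rw [h] at hSe
      exact absurd hSe (by decide)

/-- A blue edge of `S` is an open edge of `Sᶜ`. -/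
theorem compl_eq_true_of_eq_false {S : Config E} {e : E} (h : S e = false) : Sᶜ e = true := by
  rw [compl_apply_not, h]
  rfl

/-- An open edge of `Sᶜ` is blue in `S`. -/
theorem eq_false_of_compl_eq_true {S : Config E} {e : E} (h : Sᶜ e = true) : S e = false := by
  rw [compl_apply_not] at h
  cases h' : S e
  · rfl
  · rw [h'] at h
    exact absurd h (by decide)

/-- The ends of a red bare walk from a non-terminal are non-terminals. -/
theorem ne_terminal_of_bareReach {S : Config E} {u v : V} (h : Relation.ReflTransGen (G.BareAdj a b S) u v)
    (hu : u ≠ a ∧ u ≠ b) : v ≠ a ∧ v ≠ b := by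
  induction h with
  | refl => exact hu
  | tail _ hbc _ =>
    obtain ⟨e, he, _, hj⟩ := hbc
    exact (ne_of_bare_joins he hj).2

/-- An attachment gives a blue connection to the terminal. -/
theorem conn_compl_of_attached {S : Config E} {v t : V} (h : G.Attached a b S v t) : G.Conn Sᶜ v t := by
  obtain ⟨w, hvw, e, hSe, hj⟩ := h
  exact (conn_compl_of_blueBareConn (fun _ _ => rfl) hvw).trans
    (Conn.of_openAdj ⟨e, compl_eq_true_of_eq_false hSe, hj⟩)

/-- A red bare walk is a red connection. -/
theorem conn_of_reflTransGen_bareAdj {S : Config E} {u v : V}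
    (h : Relation.ReflTransGen (G.BareAdj a b S) u v) : G.Conn S u v := by
  induction h with
  | refl => exact Conn.refl G S u
  | tail _ hbc ih => exact ih.trans (Conn.of_openAdj hbc.openAdj)

/-- A red attachment gives a red connection to the terminal. -/
theorem conn_of_redAttached {S : Config E} {v t : V} (h : G.RedAttached a b S v t) : G.Conn S v t := by
  obtain ⟨w, hvw, e, hSe, hj⟩ := h
  exact (conn_of_reflTransGen_bareAdj hvw).trans (Conn.of_openAdj ⟨e, hSe, hj⟩)

/-- `Attached` is a property of the sub-zone. -/
theorem attached_of_blueBareConn {S : Config E} {u v t : V} (h : G.BlueBareConn a b S u v)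
    (hv : G.Attached a b S v t) : G.Attached a b S u t := by
  obtain ⟨w, hvw, he⟩ := hv
  exact ⟨w, h.trans hvw, he⟩

/-- **Lemma A (blue walks)**: a blue walk from a non-terminal `u` to `v` either stays in the sub-zone of `u`
(`BlueBareConn u v`) or leaves it through an attachment to a terminal `t` and continues from `t`. -/
theorem blueBareConn_or_attached_of_conn_compl {S : Config E} {u v : V} (hu : u ≠ a ∧ u ≠ b)
    (h : G.Conn Sᶜ u v) :
    G.BlueBareConn a b S u v ∨ ∃ t, (t = a ∨ t = b) ∧ G.Attached a b S u t ∧ G.Conn Sᶜ t v := by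
  refine Conn.induction (motive := fun x => G.BlueBareConn a b S u x ∨
    ∃ t, (t = a ∨ t = b) ∧ G.Attached a b S u t ∧ G.Conn Sᶜ t x) (Or.inl (BlueBareConn.refl a b S u)) ?_ h
  intro x y _ hxy ih
  rcases ih with hx | ⟨t, ht, hatt, hconn⟩
  · by_cases hy : y = a ∨ y = b
    · obtain ⟨e, hSe, hj⟩ := hxy
      exact Or.inr ⟨y, hy, ⟨x, hx, e, eq_false_of_compl_eq_true hSe, hj⟩, Conn.refl G _ y⟩
    · exact Or.inl (hx.tail (blueBareAdj_of_openAdj_compl hxy (ne_terminal_of_blueBareConn hx hu)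
        ⟨fun h => hy (Or.inl h), fun h => hy (Or.inr h)⟩))
  · exact Or.inr ⟨t, ht, hatt, hconn.trans (Conn.of_openAdj hxy)⟩

/-- **Lemma A (red walks)**: a red walk from a non-terminal `u` to `v` either stays in the red bare cluster of `u`
or leaves it through a red attachment to a terminal `t` and continues from `t`. -/
theorem bareReach_or_redAttached_of_conn {S : Config E} {u v : V} (hu : u ≠ a ∧ u ≠ b) (h : G.Conn S u v) :
    Relation.ReflTransGen (G.BareAdj a b S) u v ∨
      ∃ t, (t = a ∨ t = b) ∧ G.RedAttached a b S u t ∧ G.Conn S t v := by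
  refine Conn.induction (motive := fun x => Relation.ReflTransGen (G.BareAdj a b S) u x ∨
    ∃ t, (t = a ∨ t = b) ∧ G.RedAttached a b S u t ∧ G.Conn S t x) (Or.inl Relation.ReflTransGen.refl) ?_ h
  intro x y _ hxy ih
  rcases ih with hx | ⟨t, ht, hatt, hconn⟩
  · by_cases hy : y = a ∨ y = b
    · obtain ⟨e, hSe, hj⟩ := hxy
      exact Or.inr ⟨y, hy, ⟨x, hx, e, hSe, hj⟩, Conn.refl G _ y⟩
    · exact Or.inl (hx.tail (bareAdj_of_openAdj hxy (ne_terminal_of_bareReach hx hu)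
        ⟨fun h => hy (Or.inl h), fun h => hy (Or.inr h)⟩))
  · exact Or.inr ⟨t, ht, hatt, hconn.trans (Conn.of_openAdj hxy)⟩

end Attached

section Adm

variable (a b c : V)

/-- The probe is blue-disconnected from a terminal `t` when its sub-zone is attached to neither terminal. -/
theorem not_conn_compl_probe {S : Config E} (hc : c ≠ a ∧ c ≠ b) (hca : ¬ G.Attached a b S c a)
    (hcb : ¬ G.Attached a b S c b) {t : V} (ht : t = a ∨ t = b) : ¬ G.Conn Sᶜ c t := by
  intro h
  rcases blueBareConn_or_attached_of_conn_compl hc h with h' | ⟨t', ht', hatt, _⟩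
  · have := ne_terminal_of_blueBareConn h' hc
    rcases ht with rfl | rfl
    · exact this.1 rfl
    · exact this.2 rfl
  · rcases ht' with rfl | rfl
    · exact hca hatt
    · exact hcb hatt

/-- The terminals are blue-disconnected when every edge between them is red and no sub-zone is attached to both. -/
theorem not_conn_compl_terminals {S : Config E} (hne : a ≠ b) (hred : ∀ e, G.Joins e a b → S e = true)
    (hboth : ∀ v, v ≠ a → v ≠ b → ¬ (G.Attached a b S v a ∧ G.Attached a b S v b)) : ¬ G.Conn Sᶜ a b := by
  intro h
  have key : ∀ x, G.Conn Sᶜ a x → x = a ∨ (x ≠ a ∧ x ≠ b ∧ G.Attached a b S x a) := by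
    intro x hx
    refine Conn.induction (motive := fun x => x = a ∨ (x ≠ a ∧ x ≠ b ∧ G.Attached a b S x a)) (Or.inl rfl) ?_ hx
    intro x y _ hxy ih
    obtain ⟨e, hSe, hj⟩ := hxy
    have hSe' : S e = false := eq_false_of_compl_eq_true hSe
    rcases ih with rfl | ⟨hxa, hxb, hatt⟩
    · by_cases hya : y = x
      · exact Or.inl hya
      · by_cases hyb : y = b
        · subst hyb
          exact absurd (hred e hj) (by rw [hSe']; decide)
        · exact Or.inr ⟨hya, hyb, y, BlueBareConn.refl _ _ _ y, e, hSe', hj.symm⟩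
    · by_cases hya : y = a
      · exact Or.inl hya
      · by_cases hyb : y = b
        · subst hyb
          exact absurd ⟨hatt, x, BlueBareConn.refl _ _ _ x, e, hSe', hj⟩ (hboth x hxa hxb)
        · refine Or.inr ⟨hya, hyb, attached_of_blueBareConn ?_ hatt⟩
          exact BlueBareConn.single
            (blueBareAdj_of_openAdj_compl ⟨e, hSe, hj⟩ ⟨hxa, hxb⟩ ⟨hya, hyb⟩).symm
  rcases key b h with hb | ⟨_, hb, _⟩
  · exact hne hb.symm
  · exact hb rfl

/-- **(F2), admissibility is per sub-zone**: `c`, `a`, `b` are pairwise blue-disconnected iff every edge between the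
terminals is red, no sub-zone is attached to both terminals, and the sub-zone of `c` is attached to neither. -/
theorem adm_iff {S : Config E} (hc : c ≠ a ∧ c ≠ b) (hne : a ≠ b) :
    (¬ G.Conn Sᶜ c a ∧ ¬ G.Conn Sᶜ c b ∧ ¬ G.Conn Sᶜ a b) ↔
      ((∀ e, G.Joins e a b → S e = true) ∧
        (∀ v, v ≠ a → v ≠ b → ¬ (G.Attached a b S v a ∧ G.Attached a b S v b)) ∧
        ¬ G.Attached a b S c a ∧ ¬ G.Attached a b S c b) := by
  constructor
  · rintro ⟨hca, hcb, hab⟩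
    refine ⟨fun e he => ?_, fun v _ _ hv => ?_, fun h => hca (conn_compl_of_attached h),
      fun h => hcb (conn_compl_of_attached h)⟩
    · by_contra hSe
      have hSe' : S e = false := by
        cases h : S e
        · rfl
        · exact absurd h hSe
      exact hab (Conn.of_openAdj ⟨e, compl_eq_true_of_eq_false hSe', he⟩)
    · exact hab ((conn_compl_of_attached hv.1).symm.trans (conn_compl_of_attached hv.2))
  · rintro ⟨hred, hboth, hca, hcb⟩
    exact ⟨not_conn_compl_probe a b c hc hca hcb (Or.inl rfl), not_conn_compl_probe a b c hc hca hcb (Or.inr rfl),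
      not_conn_compl_terminals a b hne hred hboth⟩

/-- `IsCubeState` with its admissibility read per sub-zone. -/
theorem isCubeState_iff [Fintype V] [Fintype E] [DecidableEq E] (hc : c ≠ a ∧ c ≠ b) (hne : a ≠ b)
    {O S : Config E} :
    G.IsCubeState a b c O S ↔
      (∀ e, G.Bare a b e → O e = true → S e = true) ∧
        (∀ e, G.Bare a b e → O e = false → S e = true → G.InteriorBlue a b O e) ∧
        ((∀ e, G.Joins e a b → S e = true) ∧
          (∀ v, v ≠ a → v ≠ b → ¬ (G.Attached a b S v a ∧ G.Attached a b S v b)) ∧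
          ¬ G.Attached a b S c a ∧ ¬ G.Attached a b S c b) := by
  unfold IsCubeState
  rw [adm_iff a b c hc hne]

end Adm

section Valid

variable (a b c : V)

/-- A red walk from the probe to a terminal `t` leaves `K(S)` through a red terminal edge (possibly to the other
terminal). -/
theorem exists_redAttached_of_conn {S : Config E} (hc : c ≠ a ∧ c ≠ b) {t : V} (ht : t = a ∨ t = b)
    (h : G.Conn S c t) : ∃ t', (t' = a ∨ t' = b) ∧ G.RedAttached a b S c t' := by
  rcases bareReach_or_redAttached_of_conn hc h with h' | ⟨t', ht', hatt, _⟩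
  · have := ne_terminal_of_bareReach h' hc
    rcases ht with rfl | rfl
    · exact absurd rfl this.1
    · exact absurd rfl this.2
  · exact ⟨t', ht', hatt⟩

/-- **(F3), validity from `K(S)`** (`12 ∈ E`): when every edge between the terminals is red, the probe is red-joined to
both terminals iff some vertex of `K(S)` carries a red terminal edge. -/
theorem valid_iff {S : Config E} (hc : c ≠ a ∧ c ≠ b) (hab : ∃ e, G.Joins e a b)
    (hred : ∀ e, G.Joins e a b → S e = true) :
    (G.Conn S c a ∧ G.Conn S c b) ↔
      ∃ w ∈ G.BareReach a b c S, ∃ e, S e = true ∧ (G.Joins e w a ∨ G.Joins e w b) := by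
  obtain ⟨e₀, he₀⟩ := hab
  have hab' : G.Conn S a b := Conn.of_openAdj ⟨e₀, hred e₀ he₀, he₀⟩
  constructor
  · rintro ⟨hca, _⟩
    obtain ⟨t', ht', w, hw, e, hSe, hj⟩ := exists_redAttached_of_conn a b c hc (Or.inl rfl) hca
    refine ⟨w, hw, e, hSe, ?_⟩
    rcases ht' with rfl | rfl
    · exact Or.inl hj
    · exact Or.inr hj
  · rintro ⟨w, hw, e, hSe, hj⟩
    have hcw : G.Conn S c w := conn_of_reflTransGen_bareAdj hw
    rcases hj with hj | hj
    · have hca : G.Conn S c a := hcw.trans (Conn.of_openAdj ⟨e, hSe, hj⟩)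
      exact ⟨hca, hca.trans hab'⟩
    · have hcb : G.Conn S c b := hcw.trans (Conn.of_openAdj ⟨e, hSe, hj⟩)
      exact ⟨hcb.trans hab'.symm, hcb⟩

/-- **(F3) for cube states, negated form («blue at `K`»)**: with an edge between the terminals, a cube state is
invalid iff every terminal edge at a vertex of `K(S)` is blue. -/
theorem rcInvalid_iff [Fintype V] [Fintype E] [DecidableEq E] (hc : c ≠ a ∧ c ≠ b) (hab : ∃ e, G.Joins e a b)
    {O S : Config E} (hS : G.IsCubeState a b c O S) :
    G.RcInvalid a b c S ↔ ∀ w ∈ G.BareReach a b c S, ∀ e, (G.Joins e w a ∨ G.Joins e w b) → S e = false := by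
  have hred : ∀ e, G.Joins e a b → S e = true := fun e he => by
    by_contra h
    have hSe : S e = false := by
      cases h' : S e
      · rfl
      · exact absurd h' h
    exact hS.2.2.2.2 (Conn.of_openAdj ⟨e, compl_eq_true_of_eq_false hSe, he⟩)
  unfold RcInvalid
  rw [valid_iff a b c hc hab hred]
  constructor
  · intro h w hw e hj
    by_contra hSe
    have hSe' : S e = true := by
      cases h' : S e
      · exact absurd h' hSe
      · rfl
    exact h ⟨w, hw, e, hSe', hj⟩
  · rintro h ⟨w, hw, e, hSe, hj⟩
    rw [h w hw e hj] at hSe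
    exact absurd hSe (by decide)

end Valid

end MultiGraph

end PercRepro
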